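/-
Copyright (c) 2026 the pub-hodgecm-mathlib formalisation cell (harness21).  Prover seat hodgecm-mathlib-K2E3-p06 (g4), Track B «K2-LIT», engine E3, unit U4 «Keys»; deal (D61)
LINE LEAD of the open leaf (U4f-χ₁-ram-one), design D-I v2 (O1) «(R-D) is free by torus dilation», step Z2A-2 generic (plan `K2/K2E3-p06/g4/PLAN-Z2A-BranchA.K2E3-p06-g4.md`
step 2, sign per K2E3-r01 (g3) (R1)); 2026-09-04.  KERNEL module: THEOREMS ONLY (no definition, no named fact, no `sorry`, no instance, no notation).
-/
import Summits.HodgeConjecture.HodgeConjecture.Theorems.K2E3TypeVectorOfSubrep   -- ★ p857999 (V2): `apply_eq_mul_one`; brings ★ `SmoothInduction`, ★ `CompactOpenAveraging`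
import Literature.NumberTheory.Automorphic.JacquetModule                          -- ★ `ParabolicTriple.IwahoriDatum` (`hasBasis_K`, `exists_conj_inf_Nbar_le`, `a_mem`)
import HarnessLib

/-!
# K2 ∕ E3 «EllipticInputs», unit U4 «Keys» — (U4f-χ₁-ram-one) step Z2A-2 (generic): DILATION BY THE CONTRACTING ELEMENT OF AN IWAHORI DATUM
# «inside any `G`-stable `V ∋ f` with `f(1) ≠ 0` there is `aⁱ·f ∈ V`, still `≠ 0` at `1`, FIXED BY `K_n ∩ N̄`»   [Casselman1995 Prop. 1.4.4, §3.3; BernsteinZelevinsky1976 §3; BruhatTits1972 (4.4.3)]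

Cell hodgecm-mathlib (D-0151), FLOOR 0, Track B «K2-LIT», engine E3, crux item H413 = stmt-HodgeConjecture-24833 (route `HCCMUnconditional`, no route verbs); target BY NAME
the OPEN leaf `…K2E3EllipticInputs.U4Keys.sig_K2E3KeysThmTwoContractingRamifiedCharOne` (U4Keys ED. 7), design D-I v2, plan step Z2A (Branch A), generic part 2 of 3 (Z2A-1 =
★ `K2E3DepthZeroIwahoriCharacter` the character, Z2A-2 = this dilation, Z2A-3 = CM assembly with ★ (V2b) + ★ Z2-gen + the one integral).  Author K2E3-p06 (g4), line lead (D61).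
`--supports stmt-HodgeConjecture-24833 --as helper`; THEOREMS ONLY.  NOT THE PAYER.

THE POINT (design v2 (O1); K2E3-r01 (g3)'s (R-D) «`V ∩ i(χ)^{(J,χ̃)} ≠ 0`»).  ★ (V2b) `exists_typeVector_of_mem_of_factored` produces the type vector once the `N̄`-part `C = K_n ∩ N̄`
of the type group FIXES the section.  The tree's `ParabolicTriple.IwahoriDatum` (★ `JacquetModule`; instantiated at every non-split place with `K 0 = I` by ★
`K2E3IwahoriLevelDatumPF.exists_iwahoriDatum_iwahoriLevel`) packages exactly the needed dynamics: a contracting `a ∈ M`, compact open `K_n ↘ 1` (`hasBasis_K`), and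
`exists_conj_inf_Nbar_le : ∀ n j, ∃ i, a^{−i} (K_n ∩ N̄) a^{i} ≤ K_j`.  Hence for a SMOOTH vector `v`: `Stab v ⊇ K_j` for some `j`, so `a^{−i}(K_n ∩ N̄)a^{i} ⊆ Stab v`, i.e.
**`K_n ∩ N̄ ⊆ Stab(aⁱ·v)`** (§1).  For the smooth induced representation from `H ⊇ M ∋ a` and a section `f` with `f(1) ≠ 0`: `(aⁱ·f)(1) = f(aⁱ) = τ(aⁱ)·f(1) ≠ 0` and `aⁱ·f` stays in
every `G`-stable `V ∋ f` (§2).  With ★ Z2A-1 (`θ = χ₁(j₀₀)` on `I`) and ★ (V2b) this yields the `(I, χ̃)`-type vector inside the kernel subrepresentation of ★ (V1) — step 3 of PLAN-Z2A.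
* §1 `exists_pow_smul_fixed_by_inf_Nbar` (any `k`-linear representation, any smooth vector).
* §2 **`exists_dilate_typeReady`** (smooth induction, one-dimensional `τ`, `a ∈ H`): `∃ i, aⁱ·f ∈ V ∧ (aⁱ·f)(1) ≠ 0 ∧ ∀ x ∈ K_n ⊓ N̄, x·(aⁱ·f) = aⁱ·f`.
HONEST LABEL: HC_CM is proved only modulo the 7 printed citations (2 remaining named inputs: hLiu418 = stmt-HodgeConjecture-24832, h413 = stmt-HodgeConjecture-24833)
until rung 0 closes; count-neutral — this file does NOT pay the leaf; no printed citation is discharged.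

## References
* [Casselman1995] W. Casselman, *Introduction to the theory of admissible representations of `p`-adic reductive groups* (1995), Prop. 1.4.4 (Iwahori factorisation and the
  contracting element), §3.3 (the argument behind Jacquet's lemma).
* [BernsteinZelevinsky1976] I. N. Bernstein, A. V. Zelevinsky, Russian Math. Surveys 31:3 (1976), §3 (stabilisers of smooth vectors).
* [BruhatTits1972] F. Bruhat, J. Tits, Publ. Math. IHÉS 41 (1972), (4.4.3)–(4.4.4).
-/

set_option autoImplicit false
-- the mandated namespace has the single-problem summit's repeated segment (`HodgeConjecture.HodgeConjecture`)
set_option linter.dupNamespace false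

noncomputable section

open Literature.NumberTheory.Automorphic
open scoped Pointwise

namespace Summit.HodgeConjecture.HodgeConjecture.Cruxes.H413.K2E3IwahoriDatumDilation

open Summit.HodgeConjecture.HodgeConjecture.Cruxes.H413 Summit.HodgeConjecture.HodgeConjecture.Cruxes.H413.K2E3TypeVectorOfSubrep

/-! ## §1 Dilating a smooth vector until `K_n ∩ N̄` fixes it -/

section Generic

variable {k : Type*} [Field k] {G : Type*} [Group G] [TopologicalSpace G] {W : Type*} [AddCommGroup W] [Module k W]

/-- **`K_n ∩ N̄ ⊆ Stab(aⁱ·v)` for `i ≫ 0`** (`v` a smooth vector of any representation, `𝓘` an Iwahori datum): `Stab v` is an open neighbourhood of `1`, so `K_j ⊆ Stab v` for some `j`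
(`hasBasis_K`); `a^{−i}(K_n ∩ N̄)a^{i} ⊆ K_j` for some `i` (`exists_conj_inf_Nbar_le`); and `x·(aⁱ·v) = aⁱ·((a^{−i} x aⁱ)·v) = aⁱ·v`. [cite: Casselman1995, Prop. 1.4.4, §3.3]
[cite: BernsteinZelevinsky1976, §3] -/
theorem exists_pow_smul_fixed_by_inf_Nbar (t : ParabolicTriple G) (𝓘 : t.IwahoriDatum) (ρ : Representation k G W) {v : W} (hv : ρ.IsSmoothVector v) (n : ℕ) :
    ∃ i : ℕ, ∀ x ∈ 𝓘.K n ⊓ 𝓘.Nbar, ρ x (ρ (𝓘.a ^ i) v) = ρ (𝓘.a ^ i) v := by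
  -- a small `K_j` inside the open stabiliser
  obtain ⟨j, hj⟩ := 𝓘.hasBasis_K _ (hv.mem_nhds ((ρ.mem_stabilizerSubgroup v 1).2 (by rw [map_one, Module.End.one_apply])))
  obtain ⟨i, hi⟩ := 𝓘.exists_conj_inf_Nbar_le n j
  refine ⟨i, fun x hx => ?_⟩
  have hconj : (𝓘.a ^ i)⁻¹ * x * 𝓘.a ^ i ∈ 𝓘.K j := by
    have h := hi (Subgroup.smul_mem_pointwise_smul x (ConjAct.toConjAct (𝓘.a ^ i)⁻¹) _ hx)
    rwa [ConjAct.smul_def, ConjAct.ofConjAct_toConjAct, inv_inv] at h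
  have hfix : ρ ((𝓘.a ^ i)⁻¹ * x * 𝓘.a ^ i) v = v := (ρ.mem_stabilizerSubgroup v _).1 (hj hconj)
  calc ρ x (ρ (𝓘.a ^ i) v) = ρ (𝓘.a ^ i) (ρ ((𝓘.a ^ i)⁻¹ * x * 𝓘.a ^ i) v) := by
        rw [← Module.End.mul_apply, ← map_mul, ← Module.End.mul_apply, ← map_mul, ← mul_assoc, ← mul_assoc, mul_inv_cancel, one_mul]
    _ = ρ (𝓘.a ^ i) v := by rw [hfix]

end Generic

/-! ## §2 The induced case: dilation keeps `f(1) ≠ 0` and stays in `V` -/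

variable {G : Type*} [Group G] [TopologicalSpace G] [IsTopologicalGroup G] (H : Subgroup G) (τ : Representation ℂ ↥H ℂ)

/-- **DILATION, TYPE-READY FORM** (smooth induction from a one-dimensional `τ`; `𝓘` an Iwahori datum of a parabolic triple `t` with `t.M ≤ H`): for `f ∈ V` (`V` a `G`-stable
submodule) with `f(1) ≠ 0` and any level `n` there is `i` with `aⁱ·f ∈ V`, `(aⁱ·f)(1) = τ(aⁱ)·f(1) ≠ 0` (`aⁱ ∈ M ≤ H`, section property) and `aⁱ·f` FIXED BY `K_n ∩ N̄` (§1) — the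
hypotheses `hCf`, `hf1` of ★ (V2b) `exists_typeVector_of_mem_of_factored` for `C = K_n ∩ N̄`. [cite: Casselman1995, Prop. 1.4.4, §3.3] [cite: BruhatTits1972, (4.4.3)] -/
theorem exists_dilate_typeReady (t : ParabolicTriple G) (𝓘 : t.IwahoriDatum) (hMH : t.M ≤ H)
    (V : Subrepresentation (Representation.smoothIndRep H τ)) (f : Representation.SmoothInd H τ) (hfV : f ∈ V) (hf1 : f.toFun 1 ≠ 0) (n : ℕ) :
    ∃ i : ℕ, Representation.smoothIndRep H τ (𝓘.a ^ i) f ∈ V ∧ (Representation.smoothIndRep H τ (𝓘.a ^ i) f).toFun 1 ≠ 0 ∧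
      ∀ x ∈ 𝓘.K n ⊓ 𝓘.Nbar, Representation.smoothIndRep H τ x (Representation.smoothIndRep H τ (𝓘.a ^ i) f) = Representation.smoothIndRep H τ (𝓘.a ^ i) f := by
  obtain ⟨i, hi⟩ := exists_pow_smul_fixed_by_inf_Nbar t 𝓘 (Representation.smoothIndRep H τ) (Representation.isSmooth_smoothInd H τ f) n
  refine ⟨i, V.apply_mem_toSubmodule _ hfV, ?_, hi⟩
  -- `(aⁱ·f)(1) = f(aⁱ) = τ(aⁱ) f(1)`
  have hai : 𝓘.a ^ i ∈ H := hMH (pow_mem 𝓘.a_mem i)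
  have h := f.toFun_subgroup_mul (⟨𝓘.a ^ i, hai⟩ : ↥H) 1
  rw [mul_one, apply_eq_mul_one] at h
  rw [Representation.toFun_smoothIndRep_apply, one_mul, h]
  refine mul_ne_zero ?_ hf1
  intro h0
  have hinv : τ ((⟨𝓘.a ^ i, hai⟩ : ↥H)⁻¹) (τ (⟨𝓘.a ^ i, hai⟩ : ↥H) 1) = 1 := by
    rw [← Module.End.mul_apply, ← map_mul, inv_mul_cancel, MonoidHom.map_one, Module.End.one_apply]
  rw [h0, map_zero] at hinv
  exact zero_ne_one hinv

end Summit.HodgeConjecture.HodgeConjecture.Cruxes.H413.K2E3IwahoriDatumDilation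

end
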